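/-
  HodgeLocusCensusUnitColumnRankLevelsWilson.lean — pub-hlocus ENGINE B (ivhs-2, gen 55), PROBE 16b (successor material, R-L573 (e); probe-only, NOT filed).
  certified instances and evidence bearing on the general Hodge conjecture; no claim.

  KERNEL RANK THEOREMS (evidence class; no census number changes; nothing about HC). THE UNIT COLUMN OF EVERY POWER AT EVERY LEVEL IN EVERY CHARACTERISTIC
  WITH c! ≠ 0 (`rank_mulDeltaPow_levels_eq_sum_wilson`): for a field K with [CharP K p] and c! ≠ 0 in K, the rank of anchor 229's multiplicity matrix of
  ×q^c on K[x₁,…,x_k]/(xᵢ^{e+2}) (rows of codegree j, columns of codegree j + c(e+1); VERBATIM) equals anchor 230's block sum `rank_mulDeltaPow_levels_eq_sum`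
  with EVERY BLOCK c!·W_{t,t+c} on the k − s zero coordinates of the label μ (s = #{μ ≠ 0}, t = (j + Σμ)/(e+1) − s) EVALUATED by PROBE 16a's
  `rank_smul_incl_eq` (Wilson 1990, Theorem 1, both ranges): an explicit double sum in k, e, c, j, p. `rank_mulDeltaPow_levels_eq_sum_wilson_of_lt`: the
  same for every prime p > c (THEOREM L's modular regime; `cast_factorial_ne_zero`). With anchor 230's `rank_mulDeltaPow_levels_eq_zero_of_charP` (p ≤ c ⇒
  rank 0) the rank is thereby a closed formula in EVERY prime characteristic; at p = 0 / p > every binomial involved it is THEOREM L (anchor 229).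
  `card_zero_eq`: #{x : Fin k // μ x = 0} = k − #{μ ≠ 0}.
  3 theorems, 0 defs; imports Mathlib, PROBE 16a `…HodgeLocusCensusInclusionRankComplement` and anchor 230 `…HodgeLocusCensusUnitColumnRankLevelsChar`
  by name; nothing restated but anchor 229's matrix and anchor 230's summation condition (VERBATIM); no sorries, axioms, instances or notation.
-/
import Mathlib
import Summits.HodgeConjecture.HodgeConjecture.Theorems.HodgeLocusCensusInclusionRankComplement
import Summits.HodgeConjecture.HodgeConjecture.Theorems.HodgeLocusCensusUnitColumnRankLevelsChar

set_option linter.dupNamespace false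
set_option autoImplicit false

namespace Summit.HodgeConjecture.HodgeConjecture.HodgeLocus.Census.UnitColumnRankLevelsWilson

open Summit.HodgeConjecture.HodgeConjecture.HodgeLocus.Census.ModelNonJumpC1All (colR)
open Summit.HodgeConjecture.HodgeConjecture.HodgeLocus.Census.UnitColumnRankLevelsChar (rank_mulDeltaPow_levels_eq_sum)
open Summit.HodgeConjecture.HodgeConjecture.HodgeLocus.Census.InclusionRankComplement (rank_smul_incl_eq cast_factorial_ne_zero)

/-! ## §9 the unit column of `×q^c` at every level when `c! ≠ 0` in `K`: anchor 230's block sum, every block evaluated by PROBE 16a `rank_smul_incl_eq` (Wilson) -/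

/-- the number of zero coordinates of a label `μ` is `k − #{μ ≠ 0}`. -/
theorem card_zero_eq (k e : ℕ) (μ : Fin k → Fin (e + 1)) :
    Fintype.card {x : Fin k // (μ x : ℕ) = 0} = k - (Finset.univ.filter (fun l => (μ l : ℕ) ≠ 0)).card := by
  have h := Finset.card_filter_add_card_filter_not (s := (Finset.univ : Finset (Fin k)))
    (fun l => (μ l : ℕ) = 0)
  rw [Finset.card_univ, Fintype.card_fin] at h
  rw [Fintype.card_subtype]
  have h' : (Finset.univ.filter (fun l => ¬ ((μ l : ℕ) = 0))).card =
      (Finset.univ.filter (fun l => (μ l : ℕ) ≠ 0)).card := rfl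
  omega

/-- (LW-p) THE UNIT COLUMN OF EVERY POWER AT EVERY LEVEL IN EVERY CHARACTERISTIC NOT KILLING `c!`:
for a field `K` of characteristic `p` (prime or `0`) with `c! ≠ 0` in `K`, the rank of anchor 229's multiplicity matrix of
`×q^c` (VERBATIM) is anchor 230's block sum with every block `c! • W_{t,t+c}` on the `k − s` zero coordinates
(`s = #{μ ≠ 0}`, `t = (j + Σμ)/(e+1) − s`) EVALUATED by Wilson's theorem: `0` if `k − s < t + c`; Wilson's sum
`Σ_{i ≤ t, p ∤ C(t+c−i,t−i)} (C(k−s,i) − C(k−s,i−1))` if `2t + c ≤ k − s`; the complementary Wilson sum otherwise. -/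
theorem rank_mulDeltaPow_levels_eq_sum_wilson (K : Type*) [Field K] (p : ℕ) [CharP K p] (k e c j : ℕ)
    (hc : ((c.factorial : ℕ) : K) ≠ 0) :
    (Matrix.of fun (v : {v : Fin k → Fin (e + 2) // (∑ i, (v i : ℕ)) + j = k * (e + 1)})
        (m : {m : Fin k → Fin (e + 2) // (∑ i, (m i : ℕ)) + (j + c * (e + 1)) = k * (e + 1)}) =>
      ((((List.flatMap (colR (e + 3)))^[c] [List.ofFn (fun i => (m.1 i : ℕ))]).count (List.ofFn (fun i => (v.1 i : ℕ))) : ℕ) : K)).rank =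
      ∑ μ : Fin k → Fin (e + 1),
        (if (e + 1) ∣ (j + ∑ i, (μ i : ℕ)) ∧ (e + 1) * (Finset.univ.filter (fun l => (μ l : ℕ) ≠ 0)).card ≤ j + ∑ i, (μ i : ℕ) then
          (if k - (Finset.univ.filter (fun l => (μ l : ℕ) ≠ 0)).card <
              ((j + ∑ i, (μ i : ℕ)) / (e + 1) - (Finset.univ.filter (fun l => (μ l : ℕ) ≠ 0)).card) + c then 0
           else if ((j + ∑ i, (μ i : ℕ)) / (e + 1) - (Finset.univ.filter (fun l => (μ l : ℕ) ≠ 0)).card) +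
              (((j + ∑ i, (μ i : ℕ)) / (e + 1) - (Finset.univ.filter (fun l => (μ l : ℕ) ≠ 0)).card) + c) ≤
              k - (Finset.univ.filter (fun l => (μ l : ℕ) ≠ 0)).card then
             ∑ i ∈ Finset.range (((j + ∑ i, (μ i : ℕ)) / (e + 1) - (Finset.univ.filter (fun l => (μ l : ℕ) ≠ 0)).card) + 1),
               if p ∣ (((j + ∑ i, (μ i : ℕ)) / (e + 1) - (Finset.univ.filter (fun l => (μ l : ℕ) ≠ 0)).card) + c - i).choose
                   (((j + ∑ i, (μ i : ℕ)) / (e + 1) - (Finset.univ.filter (fun l => (μ l : ℕ) ≠ 0)).card) - i) then 0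
               else ((k - (Finset.univ.filter (fun l => (μ l : ℕ) ≠ 0)).card).choose i -
                 if i = 0 then 0 else (k - (Finset.univ.filter (fun l => (μ l : ℕ) ≠ 0)).card).choose (i - 1))
           else
             ∑ i ∈ Finset.range (k - (Finset.univ.filter (fun l => (μ l : ℕ) ≠ 0)).card -
                 ((((j + ∑ i, (μ i : ℕ)) / (e + 1) - (Finset.univ.filter (fun l => (μ l : ℕ) ≠ 0)).card)) + c) + 1),
               if p ∣ (k - (Finset.univ.filter (fun l => (μ l : ℕ) ≠ 0)).card -
                   (((j + ∑ i, (μ i : ℕ)) / (e + 1) - (Finset.univ.filter (fun l => (μ l : ℕ) ≠ 0)).card)) - i).choose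
                   (k - (Finset.univ.filter (fun l => (μ l : ℕ) ≠ 0)).card -
                     ((((j + ∑ i, (μ i : ℕ)) / (e + 1) - (Finset.univ.filter (fun l => (μ l : ℕ) ≠ 0)).card)) + c) - i) then 0
               else ((k - (Finset.univ.filter (fun l => (μ l : ℕ) ≠ 0)).card).choose i -
                 if i = 0 then 0 else (k - (Finset.univ.filter (fun l => (μ l : ℕ) ≠ 0)).card).choose (i - 1)))
        else 0) := by
  rw [rank_mulDeltaPow_levels_eq_sum K k e c j]
  refine Finset.sum_congr rfl (fun μ _ => ?_)
  by_cases hμ : (e + 1) ∣ (j + ∑ i, (μ i : ℕ)) ∧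
      (e + 1) * (Finset.univ.filter (fun l => (μ l : ℕ) ≠ 0)).card ≤ j + ∑ i, (μ i : ℕ)
  · rw [if_pos hμ, if_pos hμ, rank_smul_incl_eq K p c _ hc, card_zero_eq k e μ]
  · rw [if_neg hμ, if_neg hμ]

/-- (LW-p′) in particular for every prime `p > c` (THEOREM L's modular regime): `c!` is a unit. Together with anchor 230's
`rank_mulDeltaPow_levels_eq_zero_of_charP` (`p ≤ c`: rank `0`) this decides the rank in EVERY prime characteristic. -/
theorem rank_mulDeltaPow_levels_eq_sum_wilson_of_lt (K : Type*) [Field K] (p : ℕ) [CharP K p] (hp : p.Prime)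
    (k e c j : ℕ) (hcp : c < p) :
    (Matrix.of fun (v : {v : Fin k → Fin (e + 2) // (∑ i, (v i : ℕ)) + j = k * (e + 1)})
        (m : {m : Fin k → Fin (e + 2) // (∑ i, (m i : ℕ)) + (j + c * (e + 1)) = k * (e + 1)}) =>
      ((((List.flatMap (colR (e + 3)))^[c] [List.ofFn (fun i => (m.1 i : ℕ))]).count (List.ofFn (fun i => (v.1 i : ℕ))) : ℕ) : K)).rank =
      ∑ μ : Fin k → Fin (e + 1),
        (if (e + 1) ∣ (j + ∑ i, (μ i : ℕ)) ∧ (e + 1) * (Finset.univ.filter (fun l => (μ l : ℕ) ≠ 0)).card ≤ j + ∑ i, (μ i : ℕ) then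
          (if k - (Finset.univ.filter (fun l => (μ l : ℕ) ≠ 0)).card <
              ((j + ∑ i, (μ i : ℕ)) / (e + 1) - (Finset.univ.filter (fun l => (μ l : ℕ) ≠ 0)).card) + c then 0
           else if ((j + ∑ i, (μ i : ℕ)) / (e + 1) - (Finset.univ.filter (fun l => (μ l : ℕ) ≠ 0)).card) +
              (((j + ∑ i, (μ i : ℕ)) / (e + 1) - (Finset.univ.filter (fun l => (μ l : ℕ) ≠ 0)).card) + c) ≤
              k - (Finset.univ.filter (fun l => (μ l : ℕ) ≠ 0)).card then
             ∑ i ∈ Finset.range (((j + ∑ i, (μ i : ℕ)) / (e + 1) - (Finset.univ.filter (fun l => (μ l : ℕ) ≠ 0)).card) + 1),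
               if p ∣ (((j + ∑ i, (μ i : ℕ)) / (e + 1) - (Finset.univ.filter (fun l => (μ l : ℕ) ≠ 0)).card) + c - i).choose
                   (((j + ∑ i, (μ i : ℕ)) / (e + 1) - (Finset.univ.filter (fun l => (μ l : ℕ) ≠ 0)).card) - i) then 0
               else ((k - (Finset.univ.filter (fun l => (μ l : ℕ) ≠ 0)).card).choose i -
                 if i = 0 then 0 else (k - (Finset.univ.filter (fun l => (μ l : ℕ) ≠ 0)).card).choose (i - 1))
           else
             ∑ i ∈ Finset.range (k - (Finset.univ.filter (fun l => (μ l : ℕ) ≠ 0)).card -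
                 ((((j + ∑ i, (μ i : ℕ)) / (e + 1) - (Finset.univ.filter (fun l => (μ l : ℕ) ≠ 0)).card)) + c) + 1),
               if p ∣ (k - (Finset.univ.filter (fun l => (μ l : ℕ) ≠ 0)).card -
                   (((j + ∑ i, (μ i : ℕ)) / (e + 1) - (Finset.univ.filter (fun l => (μ l : ℕ) ≠ 0)).card)) - i).choose
                   (k - (Finset.univ.filter (fun l => (μ l : ℕ) ≠ 0)).card -
                     ((((j + ∑ i, (μ i : ℕ)) / (e + 1) - (Finset.univ.filter (fun l => (μ l : ℕ) ≠ 0)).card)) + c) - i) then 0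
               else ((k - (Finset.univ.filter (fun l => (μ l : ℕ) ≠ 0)).card).choose i -
                 if i = 0 then 0 else (k - (Finset.univ.filter (fun l => (μ l : ℕ) ≠ 0)).card).choose (i - 1)))
        else 0) :=
  rank_mulDeltaPow_levels_eq_sum_wilson K p k e c j (cast_factorial_ne_zero K p hp c hcp)

end Summit.HodgeConjecture.HodgeConjecture.HodgeLocus.Census.UnitColumnRankLevelsWilson
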